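import Summits.BirchSwinnertonDyer.Rank1Residual.X12.O11.RouteUPrimePsi
import Literature.NumberTheory.QuadraticFields.KroneckerSplitting
import Mathlib.NumberTheory.LegendreSymbol.QuadraticReciprocity
import Mathlib.NumberTheory.LegendreSymbol.JacobiSymbol
import HarnessLib

/-!
# K12r@3 — the K-LAYER of the «3-unit regime» at `p = 3`: the Kronecker character `ε_K` of a
# Heegner field `K = ℚ(√−m)` (`m ≡ 3 (mod 4)`) with values in `ℚ₃`, and the Bernoulli hypothesis of
# Kriz–Li Thm. 1.20 ASSEMBLED from two certified primitive characters for an EVEN `ψ`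
# (cell `bsd-print-cfram`, seat p3 g1; crux C1 `CMRamifiedThreeBSD`, stmt-BirchSwinnertonDyer-20371)

HONEST FRAMING (cell `bsd-print-cfram`, run/shared/lean/pub/bsd-print-cfram/, D-0131 (2) print
tier; verbatim in every file of the cell): the cell works the partition leaf
`CornerF ∧ p ramified in the CM field K` (LADDER-BSD row K7r = B13; W-ALL row 12r) in PARTITION
currency — a leaf or a cell counts only when its theorem is in the kernel BY NAME. Nothing here is a
Literature statement, no named fact is introduced, nothing is asserted about BSD; beyond-print: NO
(Dirichlet-character bookkeeping; the `p = 3` twin of bsd-cm's `RouteUQuadraticTwin` §1 /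
`RouteUPrimePsi`, whose `ℚ₇`-valued statements are re-derived here with values in `ℚ₃`).

The binders `εK`, `hεK : IsKroneckerCharacterOf K εK` and
`hB : ¬ ‖B_{1,ψ₀⁻¹ε_K} · B_{1,ψ₀ω⁻¹}‖₃ ≤ 3⁻¹` of `JZeroThree.bsdp_three_of_thm120_unitRegime` /
`PrintCFram.bsdp_three_of_thm120_unitRegime_of_sq_twist`, for the Heegner fields of
P3-UNIT-REGIME-CENSUS with PRIME `|d_K| ≡ 3 (mod 4)` (`d_K ∈ {−11, −23, −47, −59}` serve 14 of the
27 eligible classes) and an EVEN `ψ` (the Legendre character mod a prime `q ≡ 1 (mod 4)`: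
`d* ∈ {5, 17, 41}`):

* §1 `kroneckerValue_three_of_discr_eq_neg` / `isKroneckerCharacterOf_three_changeLevel_jacobi` —
  for `d_K = −m`, `m ≡ 3 (mod 4)`, the `ℚ₃`-valued character with values `J(· | m)` IS `ε_K`
  (decomposition law: `J(ℓ | m) = (−m/ℓ)`, and `(2)` splits iff `−m ≡ 1 (mod 8)`).
* §2 `bernoulliCharOne_of_even`, `bernoulliCharTwo_of_even` — for `ψ` EVEN (so `ψ₀ = ψ`) and
  `ε_K = ε↑` lifted from level `r ∣ |d_K|`: Kriz–Li's `ψ₀⁻¹ε_K` is the lift of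
  `θ₁ = ψ⁻¹↑·ε↑` (level `f·r`) and `ψ₀ω⁻¹` is the lift of `θ₂ = ψ↑·ω⁻¹↑` (level `f·3`).
* §3 **`bernoulli_hypothesis_three_of_even`** — `hB` from: `θ₁`, `θ₂` PRIMITIVE and
  `‖B_{1,θ₁}‖₃ = ‖B_{1,θ₂}‖₃ = 1` (bsd-cm's `RouteU.bernoulli_hypothesis_of_certs`); the two unit
  statements are the per-(ψ, K) CERTIFICATES — `θ₁` has level prime to `3`
  (`PrintCFram.norm_generalizedBernoulli_one_eq_one_of_intCert`), `θ₂` has `3 ∥` level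
  (`RouteU.norm_generalizedBernoulli_one_eq_one_of_cert`, `ω(j) ≡ j³ (mod 9)`).

References: [KrizLi2019] Thm. 1.20 (pp. 7–8), §1.5 (1), §2 (pp. 11–12); [Cox2013] §1.C Lemma 1.14;
[Washington1997] Ch. 3–4; `X12/O11/RouteUQuadraticTwin.lean` §1, `RouteUPrimePsi.lean` (bsd-cm).
-/

set_option linter.dupNamespace false
set_option autoImplicit false

noncomputable section

open scoped Classical
open NumberField DirichletCharacter Literature.NumberTheory.EllipticCurves.KrizLi2019
  Literature.NumberTheory.LFunctions Literature.NumberTheory.QuadraticFields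
  Summit.BirchSwinnertonDyer.Rank1Residual.X12.O11.RouteU

namespace Summit.BirchSwinnertonDyer.BirchSwinnertonDyer.Theorems.PrintCFram

/-! ## §1 The Kronecker character of `ℚ(√−m)`, `m ≡ 3 (mod 4)`, with values in `ℚ₃` -/

section Kronecker

variable {M : Type} [Field M] [NumberField M]

/-- **Decomposition law read on the Jacobi character, negative discriminant `−m`, `m ≡ 3 (mod 4)`,
values in `ℚ₃`**: if `d_M = −m` and `κ` has values `J(· | m)`, then `κ(ℓ) = 1` if `ℓ` splits in
`M` and `−1` otherwise, for every prime `ℓ ∤ d_M` (`J(ℓ | m) = χ₄(ℓ)J(m | ℓ) = (−m/ℓ)`; at `2`: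
`χ₈(m) = 1 ⟺ m ≡ 7 (8) ⟺ −m ≡ 1 (8)`). The `ℚ₇`-valued twin is bsd-cm's
`RouteU.kroneckerValue_of_discr_eq_neg`. [cite: Cox2013, §1.C Lemma 1.14 and (1.18)] -/
theorem kroneckerValue_three_of_discr_eq_neg (hM2 : Module.finrank ℚ M = 2) {m : ℕ} (hm4 : m % 4 = 3)
    (hdM : NumberField.discr M = -(m : ℤ)) {n : ℕ} (κ : DirichletCharacter ℚ_[3] n)
    (hκ : ∀ a : ℕ, κ (a : ZMod n) = (jacobiSym a m : ℚ_[3]))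
    (ℓ : ℕ) (hℓ : ℓ.Prime) (hnd : ¬ ((ℓ : ℤ) ∣ NumberField.discr M)) :
    κ (ℓ : ZMod n) = if ((Ideal.span {(ℓ : ℤ)}).primesOver (𝓞 M)).ncard = 2 then 1 else -1 := by
  have hmodd : Odd m := Nat.odd_iff.mpr (by omega)
  have hcop : (ℓ : ℤ).gcd m = 1 := by
    rw [Int.gcd_natCast_natCast, ← Nat.coprime_iff_gcd_eq_one, Nat.Prime.coprime_iff_not_dvd hℓ]
    intro h; apply hnd; rw [hdM, dvd_neg]; exact_mod_cast h
  rw [hκ ℓ]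
  by_cases h2 : ℓ = 2
  · subst h2
    have hJ : jacobiSym 2 m = ZMod.χ₈ m := by exact_mod_cast jacobiSym.at_two hmodd
    have h8 := ZMod.χ₈_nat_eq_if_mod_eight m
    by_cases hs : ((Ideal.span {((2 : ℕ) : ℤ)}).primesOver (𝓞 M)).ncard = 2
    · rw [if_pos hs]
      have h1 : NumberField.discr M % 8 = 1 := by
        rw [Nat.cast_ofNat, Quadratic.ncard_primesOver_two_eq_two_iff hM2] at hs; exact hs
      rw [hdM] at h1
      have : m % 8 = 7 := by omega
      rw [Nat.cast_ofNat, hJ, h8, if_neg (by omega), if_pos (Or.inr this)]; simp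
    · rw [if_neg hs]
      have h1 : NumberField.discr M % 8 ≠ 1 := by
        rw [Nat.cast_ofNat, Quadratic.ncard_primesOver_two_eq_two_iff hM2] at hs; exact hs
      rw [hdM] at h1
      have : ¬ (m % 8 = 1 ∨ m % 8 = 7) := by omega
      rw [Nat.cast_ofNat, hJ, h8, if_neg (by omega), if_neg this]; simp
  · haveI := Fact.mk hℓ
    have hodd : Odd ℓ := hℓ.odd_of_ne_two h2
    have hrec : jacobiSym ℓ m = legendreSym ℓ (NumberField.discr M) := by
      rw [hdM, jacobiSym.legendreSym.to_jacobiSym, jacobiSym.neg _ hodd]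
      rcases Nat.odd_mod_four_iff.mp (Nat.odd_iff.mp hodd) with h1 | h3
      · rw [ZMod.χ₄_nat_one_mod_four h1, one_mul, jacobiSym.quadratic_reciprocity_one_mod_four h1 hmodd]
      · rw [ZMod.χ₄_nat_three_mod_four h3, jacobiSym.quadratic_reciprocity_three_mod_four h3 hm4]
        ring
    rcases jacobiSym.eq_one_or_neg_one hcop with h1 | h1
    · rw [h1, if_pos ((Quadratic.ncard_primesOver_eq_two_iff_legendreSym hM2 h2).mpr (by rw [← hrec, h1])),
        Int.cast_one]
    · have hs : ((Ideal.span {(ℓ : ℤ)}).primesOver (𝓞 M)).ncard ≠ 2 := fun hs => by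
        have := (Quadratic.ncard_primesOver_eq_two_iff_legendreSym hM2 h2).mp hs
        rw [← hrec, h1] at this; norm_num at this
      rw [h1, if_neg hs, Int.cast_neg, Int.cast_one]

/-- **`ε_K` for `K = ℚ(√−m)`, `m ≡ 3 (mod 4)`, with values in `ℚ₃`**: if `κ` mod `m` is PRIMITIVE
with values `J(· | m)` and `h : m ∣ |d_K|` (in fact `|d_K| = m`), then
`IsKroneckerCharacterOf K (changeLevel h κ)` — the binder `hεK` of
`JZeroThree.bsdp_three_of_thm120_unitRegime`. The `ℚ₇`-valued twin is bsd-cm's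
`RouteU.isKroneckerCharacterOf_changeLevel_jacobi`. [cite: KrizLi2019, §2 (p. 12, "ε_K the quadratic character associated with K")]
[cite: Cox2013, §1.C Lemma 1.14] -/
theorem isKroneckerCharacterOf_three_changeLevel_jacobi (hM2 : Module.finrank ℚ M = 2) {m : ℕ}
    [NeZero m] (hm4 : m % 4 = 3) (hdM : NumberField.discr M = -(m : ℤ))
    (κ : DirichletCharacter ℚ_[3] m) (hκp : κ.IsPrimitive)
    (hκ : ∀ a : ℕ, κ (a : ZMod m) = (jacobiSym a m : ℚ_[3]))
    (h : m ∣ (NumberField.discr M).natAbs) :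
    IsKroneckerCharacterOf M (changeLevel h κ) := by
  have hnat : (NumberField.discr M).natAbs = m := by simp [hdM]
  refine ⟨?_, fun ℓ hℓ hnd => ?_⟩
  · rw [isPrimitive_def, conductor_changeLevel, hκp, hnat]
  · have hcop : IsCoprime (ℓ : ℤ) ((NumberField.discr M).natAbs : ℕ) := by
      rw [Int.isCoprime_iff_gcd_eq_one, Int.gcd_natCast_natCast, ← Nat.coprime_iff_gcd_eq_one,
        Nat.Prime.coprime_iff_not_dvd hℓ]
      intro hdvd; apply hnd
      exact Int.dvd_natAbs.mp (by exact_mod_cast hdvd)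
    have hval : changeLevel h κ (ℓ : ZMod (NumberField.discr M).natAbs) = κ (ℓ : ZMod m) := by
      have := changeLevel_eq_cast_of_dvd' κ h hcop
      simpa [Int.cast_natCast] using this
    rw [hval]
    exact kroneckerValue_three_of_discr_eq_neg hM2 hm4 hdM κ hκ ℓ hℓ hnd

end Kronecker

/-! ## §2 Kriz–Li's two Bernoulli characters for an EVEN `ψ` and a lifted `ε_K` -/

section BernoulliChars

variable {p : ℕ} [hp : Fact p.Prime] {f D r : ℕ}

/-- **`ψ₀⁻¹ε_K` for `ψ` EVEN (`ψ₀ = ψ`) and `ε_K = ε↑` (`ε` of level `r ∣ D = |d_K|`)** is the lift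
to level `f·D` of `θ₁ := ψ⁻¹↑·ε↑` of level `f·r`. [cite: KrizLi2019, §1.5 (p. 7, ψ₀) and Thm. 1.20 (p. 8)] -/
theorem bernoulliCharOne_of_even (ψ : DirichletCharacter ℚ_[p] f) (hev : ψ.Even)
    (ε : DirichletCharacter ℚ_[p] r) (hr : r ∣ D) :
    bernoulliCharOne ψ (changeLevel hr ε) =
      changeLevel (mul_dvd_mul_left f hr)
        (changeLevel (dvd_mul_right f r) ψ⁻¹ * changeLevel (dvd_mul_left r f) ε) := by
  unfold bernoulliCharOne evenTwist
  rw [if_pos hev, map_mul, ← map_inv, ← changeLevel_trans, ← changeLevel_trans, ← changeLevel_trans]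

/-- **`ψ₀ω⁻¹` for `ψ` EVEN and `ε_K = ε↑`** is the lift to level `f·D·p` of `θ₂ := ψ↑·ω⁻¹↑` of
level `f·p`. [cite: KrizLi2019, §1.5 (p. 7, ψ₀) and Thm. 1.20 (p. 8)] -/
theorem bernoulliCharTwo_of_even (ψ : DirichletCharacter ℚ_[p] f) (hev : ψ.Even)
    (ε : DirichletCharacter ℚ_[p] r) (hr : r ∣ D) (ω : DirichletCharacter ℚ_[p] p) :
    bernoulliCharTwo ψ (changeLevel hr ε) ω =
      changeLevel (show f * p ∣ f * D * p from
          mul_dvd_mul_right (dvd_mul_right f D) p |>.trans (by rw [mul_right_comm]))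
        (changeLevel (dvd_mul_right f p) ψ * changeLevel (dvd_mul_left p f) ω⁻¹) := by
  unfold bernoulliCharTwo evenTwist
  rw [if_pos hev, map_mul, ← changeLevel_trans, ← changeLevel_trans, ← changeLevel_trans]

end BernoulliChars

/-! ## §3 The Bernoulli hypothesis of Thm. 1.20 from two certified primitive characters -/

section Assembly

variable {f D r : ℕ} [NeZero f] [NeZero D] [NeZero r]

/-- **`hB` ASSEMBLED (p = 3, `ψ` even, `ε_K = ε↑`).** If `θ₁ = ψ⁻¹↑·ε↑` (level `f·r`) and
`θ₂ = ψ↑·ω⁻¹↑` (level `f·3`) are PRIMITIVE with `‖B_{1,θ₁}‖₃ = ‖B_{1,θ₂}‖₃ = 1` (the two per-(ψ, K)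
certificates), then Kriz–Li's Bernoulli hypothesis
`¬ ‖B_{1,ψ₀⁻¹ε_K} · B_{1,ψ₀ω⁻¹}‖₃ ≤ 3⁻¹` holds for `ε_K = changeLevel (r ∣ D) ε` — the binder `hB` of
`JZeroThree.bsdp_three_of_thm120_unitRegime` (bsd-cm `RouteU.bernoulli_hypothesis_of_certs` + §2).
[cite: KrizLi2019, Thm. 1.20 (p. 8, the Bernoulli hypothesis)] -/
theorem bernoulli_hypothesis_three_of_even (ψ : DirichletCharacter ℚ_[3] f) (hev : ψ.Even)
    (ε : DirichletCharacter ℚ_[3] r) (hr : r ∣ D) (ω : DirichletCharacter ℚ_[3] 3)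
    (hθ₁ : (changeLevel (dvd_mul_right f r) ψ⁻¹ * changeLevel (dvd_mul_left r f) ε).IsPrimitive)
    (hu₁ : ‖generalizedBernoulli 1
      (changeLevel (dvd_mul_right f r) ψ⁻¹ * changeLevel (dvd_mul_left r f) ε)‖ = 1)
    (hθ₂ : (changeLevel (dvd_mul_right f 3) ψ * changeLevel (dvd_mul_left 3 f) ω⁻¹).IsPrimitive)
    (hu₂ : ‖generalizedBernoulli 1
      (changeLevel (dvd_mul_right f 3) ψ * changeLevel (dvd_mul_left 3 f) ω⁻¹)‖ = 1) :
    ¬ (‖bernoulliOnePrim (bernoulliCharOne ψ (changeLevel hr ε)) *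
        bernoulliOnePrim (bernoulliCharTwo ψ (changeLevel hr ε) ω)‖ ≤ ((3 : ℕ) : ℝ)⁻¹) := by
  haveI : Fact (Nat.Prime 3) := ⟨Nat.prime_three⟩
  exact bernoulli_hypothesis_of_certs _ hθ₁ (mul_dvd_mul_left f hr) _ hθ₂
    (show f * 3 ∣ f * D * 3 from
      mul_dvd_mul_right (dvd_mul_right f D) 3 |>.trans (by rw [mul_right_comm]))
    _ (bernoulliCharOne_of_even ψ hev ε hr) _ (bernoulliCharTwo_of_even ψ hev ε hr ω) hu₁ hu₂

end Assembly

end Summit.BirchSwinnertonDyer.BirchSwinnertonDyer.Theorems.PrintCFram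

end
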